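import Summits.ABC.IUTFork.LanaEtaAlgorithm
import HarnessLib

/-!
# L-LANA objects VII — INSTANCE / CONDITIONAL FORMS of `EtaSteps.Containment` (F-2216), named for the kernel census

PROOF-ONLY companion (0 `def`, 0 `instance`, 0 notation, 0 `Prop` fact) of the abc-iut cell, block F (seat abc-iut-f-070, gen 6;
director-abc g4 KEY `INST59F` «LF instance-form batch F»: FACT-LIST rows labelled SCHEMA-REFUTED for which the kernel census found
«no theorem in the cell concluding in this decl»). It imports — never edits — abc-iut-c312-4's `LanaEtaAlgorithm` (p404205 + append
p404920): `EtaSteps.Containment` = THE CONTAINMENT of LANA p. 36 («the image of the map `ψ_v` from (the Frobenius-like version of) the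
theta monoid `M^Θ_{v,∞}` to `∏_t ∞H¹(D_t, (l·Δ_Θ)(Π_v))` is contained in the image of `φ_v := ∏_t φ_{v,t}`» — the part of
[IUTchIII] Thm. 3.11 (ii) / Prop. 3.5 (ii) the `η`-algorithm uses), a HYPOTHESIS `Prop` over the schematic signature `EtaSteps`.

The row's instance forms ALREADY IN THE TREE conclude in the decl through dot-notation (`EtaSteps.trivial.Containment`), which the
census's conclusion-head scan does not name-match: `EtaSteps.trivial_containment` (p404205; the reviewer's satisfiability witness),
`EtaSteps.containment_of_factors` / `containment_iff_factors` (p404205; conditional on §9.1 (f)'s factorisation, resp. equivalent to it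
when the local Kummer maps are injective) and the instance REFUTER `EtaSteps.not_containment_obstructed` (p404920). This file records
them BY NAME in census-visible shape and adds the two structural sufficient conditions that say exactly WHEN the hypothesis is automatic:

* `containment_of_phiProd_surjective` — if `φ_v = ∏_t φ_{v,t}` is surjective (e.g. every local Kummer map `κ_t` surjective,
  `containment_of_kappa_surjective`), the containment holds for ANY `ψ_v`; `containment_of_subsingleton` — likewise if every
  `∞H¹(D_t, (l·Δ_Θ)(Π_v))` is trivial. (So the content of the hypothesis lives where `φ_v` is NOT onto — as in `EtaSteps.obstructed`.)
* `not_forall_containment` — the ∀-closure of the schema is false (by `not_containment_obstructed`); `containment_schema` — inhabited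
  (`trivial_containment`) ∧ refuted-at-an-instance ∧ ∀-closure false: F-2216 is a genuine schema whose instance forms are the content.

HONEST FRAMING: schematic level only (LANA Rem. 6.2.1 «necessarily schematic»); nothing here asserts that the containment holds for the
real tempered/étale-theta data, that [IUTchIII] Thm. 3.11 (ii) holds or fails, or that abc is proved or refuted; no side taken on any
author. A FACT row is an assumption label on OUR typed statement; refuted-as-typed ≠ refuted-in-print; typed ≠ proved; standard axioms.
[cite: LANA2026Report, §6.2 (g) p. 36, §9.1 (f) p. 45] [claim: Mochizuki2012, status: disputed]
-/

namespace Summit.ABC.IUTFork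

namespace EtaSteps

variable (A : EtaSteps)

/-! ## 1. When the containment is automatic (structural sufficient conditions) -/

/-- **Conditional form.** If `φ_v = ∏_t φ_{v,t}` is surjective, the containment `im ψ_v ⊆ im φ_v` holds for any `ψ_v`.
[cite: LANA2026Report, §6.2 (g) p. 36] -/
theorem containment_of_phiProd_surjective (h : Function.Surjective A.phiProd) : A.Containment := by
  rintro x -
  exact h x

/-- **Conditional form.** If every local Kummer map `κ_t : O^▷_{v,t} → ∞H¹(D_t, Λ_{v,t})` is surjective, then so is `φ_v`
(the cyclotomic synchronizations `(ι_t)_*` are isomorphisms), hence the containment holds. [cite: LANA2026Report, §6.2 (g) pp. 35–36] -/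
theorem containment_of_kappa_surjective (h : ∀ t, Function.Surjective (A.kappa t)) : A.Containment := by
  refine A.containment_of_phiProd_surjective fun y => ?_
  choose a ha using fun t => h t ((A.sync t) (y t))
  refine ⟨a, funext fun t => ?_⟩
  rw [phiProd_apply, phi_apply, ha, MulEquiv.symm_apply_apply]

/-- **Conditional form.** If every `∞H¹(D_t, (l·Δ_Θ)(Π_v))` is trivial (a subsingleton), the containment holds.
[cite: LANA2026Report, §6.2 (f) p. 35] -/
theorem containment_of_subsingleton (h : ∀ t, Subsingleton (A.H1D t)) : A.Containment := by
  rintro x -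
  exact ⟨fun _ => 1, funext fun t => Subsingleton.elim _ _⟩

/-! ## 2. The instance forms of record, by name, in census-visible shape -/

/-- **Instance form (of record: abc-iut-c312-4 `EtaSteps.trivial_containment`, p404205).** In the trivial signature the containment
holds. [folklore] -/
theorem containment_trivial : Containment EtaSteps.trivial := EtaSteps.trivial_containment

/-- The same instance through §1 (all `∞H¹(D_t, …)` are `PUnit`). [folklore] -/
theorem containment_trivial' : Containment EtaSteps.trivial :=
  EtaSteps.trivial.containment_of_subsingleton fun _ => inferInstanceAs (Subsingleton PUnit)

/-- **Instance REFUTER (of record: `EtaSteps.not_containment_obstructed`, p404920).** In `EtaSteps.obstructed` (theta monoid `ℤ`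
mapping identically into `∞H¹ = ℤ`, `O^▷_{v,t}` trivial) the containment fails. [folklore] -/
theorem not_containment_obstructed' : ¬ Containment EtaSteps.obstructed := EtaSteps.not_containment_obstructed

/-- **F-2216, ∀-closure REFUTED** (closed form, by the obstructed signature). [folklore] -/
theorem not_forall_containment : ¬ ∀ A : EtaSteps, A.Containment :=
  fun h => EtaSteps.not_containment_obstructed (h _)

/-- **Conditional form (of record: `containment_of_factors`, p404205)** restated with the decl as head: §9.1 (f)'s factorisation of
`ψ_v` through `∏_t O^▷_{v,t}` gives the containment. [cite: LANA2026Report, §9.1 (f) p. 45] -/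
theorem containment_of_factors' (h : A.Factors) : Containment A := A.containment_of_factors h

/-- **F-2216 as a SCHEMA**: inhabited (`trivial`), refuted at an instance (`obstructed`), hence ∀-closure false — the instance /
conditional forms are the row's content. [folklore] -/
theorem containment_schema :
    Containment EtaSteps.trivial ∧ ¬ Containment EtaSteps.obstructed ∧ ¬ ∀ A : EtaSteps, A.Containment :=
  ⟨EtaSteps.trivial_containment, EtaSteps.not_containment_obstructed, not_forall_containment⟩

end EtaSteps

end Summit.ABC.IUTFork
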